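import Literature.IUT.LogVolume.SubThetaFieldRamificationFifteen
import HarnessLib

/-!
# The ramification of a field pinned by the v3 Θ-datum DIVIDES `15` at a MULTIPLICATIVE place `v ∤ 30` as soon as each of
# `λ`, `λ − 1` has EITHER even `v`-order OR NO square root in the field (generator analysis of `IsSubThetaField`; proof-only)

Mochizuki, *Inter-universal Teichmüller theory IV* (RIMS manuscript Apr. 2020 = PRIMS **57** (2021)), Thm. 1.10, Step (ii)
p. 24 and Step (iii) (R2)–(R4) p. 25–26 (the ramification budget of the layer `F/F_tpd` is read off the GENERATORS of `F`:
"`F` is obtained from `F_tpd` by adjoining `√−1`, together with the fields of definition of the `(3·5)`-torsion points",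
p. 22); J. H. Silverman, *Advanced Topics in the Arithmetic of Elliptic Curves* (1994), V.4–V.5, Exercise 5.13 (b) (at a
place of MULTIPLICATIVE reduction prime to `p`, inertia acts on `E[p]` through a group of order dividing `p`).

abc-iut cell, D-0079 RESCUE sub-cell R-W «WINDOW Θ-SIDE INEQUALITY», row «W:FREY73-L19-CONVERSE» (abc-iut-plan C-R89 (a)(ii)
«the converse `√(λ−1) ∉ F ⇒ e₇ = 285` as a theorem (IsSubThetaField generator analysis)»), seat abc-iut-L6-t15 (gen 14).
PROOF-ONLY companion (0 definitions, 0 `Prop`-valued facts, no instance) of abc-iut-w4-d087's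
`SubThetaFieldRamificationFifteen` (`Cor22.ramificationIdx_subThetaField_dvd_fifteen`: `e(w | v) ∣ 15` when `E_λ` is
multiplicative at `v ∤ 30` over `F_tpd` and BOTH `λ`, `λ − 1` have EVEN `v`-order) and of abc-iut-W-neg-1's
`SubThetaFieldRamificationSixty` / `…Thirty`; every input is consumed BY NAME.

THE POINT (numbers, not adjectives). The pinning predicate `Cor22.IsSubThetaField P F` (abc-iut-S2, `ThetaFieldReading.lean`)
says `F = F_tpd(S)` where `S ⊆ F` consists of the elements `x ∈ F` with `x² ∈ {−1, λ, λ−1}` and of the coordinates of the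
`F`-rational `15`-torsion points of `E_λ`. The Fifteen proof bounds `e(w | v)` by the index in the absolute inertia group
`I` at `v` of the subgroup fixing EVERY generator; it needs inertia to fix `√λ` and `√(λ−1)` IN `F̄_tpd`, which is why it
asks for even orders. But a square root that is NOT IN `F` is not a generator, so nothing has to fix it: if NO `x ∈ F` has
`x² = λ − 1` (e.g. `√(λ−1) ∉ F` at a place `v ∣ b` of an `abc`-triple, where `ord_v(λ−1) = v(b)` may be ODD), the
`sqrtFixer (λ−1)` factor of the Fifteen/Sixty index chain is simply DROPPED. Hence:

* **`Cor22.ramificationIdx_subThetaField_dvd_fifteen_of_sq_ne`** — `P ∈ U`, `F` Galois over `F_tpd` with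
  `IsSubThetaField P F`, `w | v`, `v ∤ 30`, `E_λ` multiplicative at `v` over `F_tpd`, and for EACH of `c ∈ {λ, λ−1}`:
  `ord_v c` even OR `∀ x : F, x² ≠ c` ⟹ **`e(w | v) ∣ 15`** (subsumes `…_dvd_fifteen`, which is the even/even case);
* `Cor22.ThetaVolumeDatumAt.ramificationIdx_int_dvd_fifteen_mul_of_sq_ne` / `…_ratPoint_of_sq_ne` — the tower forms at
  a genuine Θ-volume datum (`e(u | p) ∣ e(v₀ | p)·15·l`, and `∣ 15·l` at a RATIONAL point), the `K/F` layer `e(u|w) ∣ l`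
  being abc-iut-S-d1's `ramificationIdx_dvd_prime` BY NAME exactly as in `GenuineTowerLocalType.lean`.
Consumer (sequel file `Summits/ABC/IUTFork/Conditional/GenuineKExactTameLocalTypeOfNotSquare`): at the `abc` triple
`73 + 2¹³·7⁷·941² = 3¹⁶·103³·127`, `l = 19`, the fibre type over `7` is `285 = 15·19` EXACTLY as soon as `√(λ−1) ∉ F`
— the converse of abc-iut-W-row-1's «`√(λ−1) ∈ F` ⟹ `570`» (p495544), so the TYPE-SPLIT bit at `l = 19` is the single
model clause `IsSquare (λ − 1)` in `F`, both directions in kernel.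

Proof-only; classical algebraic number theory on the cell's typed objects; TAKES NO SIDE on [IUTchIII] Cor. 3.12 or on
any author; typed ≠ proved; instantiated ≠ endorsed; nothing here asserts abc proved or refuted.
[cite: Mochizuki2012, IUTchIV Thm. 1.10 p. 22 and proof Steps (ii)–(iii) p. 24–26] [cite: SilvermanATAEC1994, V.4–V.5 and Exercise 5.13 (b)]
[claim: Mochizuki2012, status: disputed] for every IUT quotation.
-/

noncomputable section

open scoped Classical

namespace Literature.IUT.LogVolume

namespace Cor22

open NumberField IsDedekindDomain Literature.NumberTheory.DiophantineGeometry.GenEll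
open Literature.NumberTheory.EllipticCurves Literature.NumberTheory.GaloisRepresentations
open Literature.NumberTheory.NumberFields WeierstrassCurve IntermediateField Field

variable {P : NFPoint} (F : Type) [Field F] [NumberField F] [Algebra P.F F]

/-- **`e(w | v) ∣ 15`** for every place `w` of a field pinned by `IsSubThetaField P F` (Galois over `F_tpd`) over a place
`v ∤ 2·3·5` of `F_tpd` at which `E_λ` has MULTIPLICATIVE reduction over `F_tpd`, provided that EACH of `λ`, `λ − 1` has
EITHER even `v`-order OR no square root in `F`: the absolute inertia group `I` at `v` fixes `√−1` and every square root of
`λ`, `λ − 1` that actually occurs among the generators of `F` (a square root absent from `F` is not a generator), and its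
images in `Aut(E_λ[3])`, `Aut(E_λ[5])` have orders `∣ 3`, `∣ 5` (the tree's `natCard_map_inertia_galoisRepTorsion_dvd_prime`),
so `e(w|v) ∣ [I : I ∩ ker ρ̄₃ ∩ ker ρ̄₅ ∩ fixers] ∣ 3·5` — abc-iut-w4-d087's Fifteen proof with the absent square-root fixers
dropped. [cite: SilvermanATAEC1994, V.4–V.5 and Exercise 5.13 (b)] [cite: Mochizuki2012, IUTchIV Thm 1.10 p.22, proof Step (iii) (R2)–(R4) p.25–26] -/
theorem ramificationIdx_subThetaField_dvd_fifteen_of_sq_ne (hU : P.InU) (hF : IsSubThetaField P F) [IsGalois P.F F]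
    (w : HeightOneSpectrum (𝓞 F))
    (hmult : P.legendreCurve.HasMultiplicativeReductionAt (finBelow P.F F w))
    (hev : (∃ m : ℤ, (finBelow P.F F w).valuation P.F P.x = WithZero.exp (2 * m)) ∨
      ∀ x : F, x ^ 2 ≠ algebraMap P.F F P.x)
    (hev1 : (∃ m : ℤ, (finBelow P.F F w).valuation P.F (P.x - 1) = WithZero.exp (2 * m)) ∨
      ∀ x : F, x ^ 2 ≠ algebraMap P.F F P.x - 1)
    (h30 : ((30 : ℕ) : 𝓞 P.F) ∉ (finBelow P.F F w).asIdeal) :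
    w.asIdeal.ramificationIdx (𝓞 P.F) ∣ 15 := by
  -- adapted from abc-iut-w4-d087's `ramificationIdx_subThetaField_dvd_fifteen` (SubThetaFieldRamificationFifteen.lean),
  -- itself adapted from abc-iut-W-neg-1's `ramificationIdx_subThetaField_dvd_sixty` (SubThetaFieldRamificationSixty.lean)
  haveI : P.legendreCurve.IsElliptic := P.legendreCurve_isElliptic_iff.2 hU
  haveI : Fact (Nat.Prime 3) := ⟨Nat.prime_three⟩
  haveI : Fact (Nat.Prime 5) := ⟨Nat.prime_five⟩
  set v := finBelow P.F F w with hvdef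
  haveI := v.isPrime
  -- residue characteristic `∉ {2, 3, 5}`
  have hdv : ∀ a b : ℕ, 30 = a * b → ((b : ℕ) : 𝓞 P.F) ∉ v.asIdeal := fun a b hab h =>
    h30 (by rw [hab, Nat.cast_mul]; exact Ideal.mul_mem_left _ _ h)
  have h2 := hdv 15 2 rfl; have h3 := hdv 10 3 rfl; have h5 := hdv 6 5 rfl
  have h2' : (2 : 𝓞 P.F) ∉ v.asIdeal := by exact_mod_cast h2
  have h3' : (3 : 𝓞 P.F) ∉ v.asIdeal := by exact_mod_cast h3
  have h5' : (5 : 𝓞 P.F) ∉ v.asIdeal := by exact_mod_cast h5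
  -- `F ≃ L := F_tpd(φ S) ⊆ F̄_tpd`
  haveI : FiniteDimensional P.F F := Module.Finite.of_restrictScalars_finite ℚ P.F F
  set Ω := AlgebraicClosure P.F
  let φ : F →ₐ[P.F] Ω := IsAlgClosed.lift
  set S : Set F := subThetaFieldGenerators P F with hSdef
  set L : IntermediateField P.F Ω := IntermediateField.adjoin P.F (φ '' S) with hLdef
  have hL : φ.fieldRange = L := by
    rw [AlgHom.fieldRange_eq_map, ← hF.adjoin_eq_top, IntermediateField.adjoin_map]
  let e : F ≃ₐ[P.F] L :=
    (((IntermediateField.topEquiv (F := P.F) (E := F)).symm.trans (IntermediateField.equivMap ⊤ φ)).trans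
      (IntermediateField.equivOfEq (AlgHom.fieldRange_eq_map φ).symm)).trans
      (IntermediateField.equivOfEq hL)
  haveI : FiniteDimensional P.F L := LinearEquiv.finiteDimensional e.toLinearEquiv
  haveI : IsGalois P.F L := IsGalois.of_algEquiv e
  haveI : NumberField L := NumberField.of_module_finite P.F L
  -- absolute inertia at `v`
  obtain ⟨𝔓, h𝔓⟩ := HeightOneSpectrum.primesAbove_nonempty v
  haveI : 𝔓.IsPrime := h𝔓.1
  haveI : 𝔓.LiesOver v.asIdeal := h𝔓.2
  set I : Subgroup (absoluteGaloisGroup P.F) := 𝔓.inertia (absoluteGaloisGroup P.F) with hIdef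
  have h4 : ((4 : ℕ) : 𝓞 P.F) ∉ v.asIdeal := by
    intro h
    have : ((2 : ℕ) : 𝓞 P.F) * ((2 : ℕ) : 𝓞 P.F) ∈ v.asIdeal := by
      rw [← Nat.cast_mul]; exact h
    rcases (Ideal.IsPrime.mem_or_mem inferInstance this) with h' | h' <;> exact h2 h'
  -- (1a) a subgroup containing inertia which fixes (the images of) the square roots of `λ` PRESENT IN `F`:
  -- `sqrtFixer λ` when `ord_v λ` is even (inertia fixes `√λ ∈ F̄_tpd`), all of `Gal(F̄_tpd/F_tpd)` when `F` has no `√λ`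
  obtain ⟨Al, hIAl, hAl⟩ : ∃ Al : Subgroup (absoluteGaloisGroup P.F), I ≤ Al ∧
      ∀ τ ∈ Al, ∀ x : F, x ^ 2 = algebraMap P.F F P.x →
        Field.absoluteGaloisGroup.toAlgEquiv P.F τ (φ x) = φ x := by
    rcases hev with ⟨m, hm⟩ | hne
    · refine ⟨sqrtFixer P P.x, fun σ hσ => ?_, fun τ hτ x hx => ?_⟩
      · exact mem_fixingSubgroup_adjoin_of_forall_eq (σ := Field.absoluteGaloisGroup.toAlgEquiv P.F σ)
          fun z hz => smul_eq_of_mem_inertia_of_sq_eq_of_valuation_eq_exp_even v h𝔓 hσ h2' hm hz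
      · have : (φ x) ^ 2 = algebraMap P.F Ω P.x := by rw [← map_pow, hx, φ.commutes]
        exact forall_eq_of_mem_fixingSubgroup_adjoin hτ _ this
    · exact ⟨⊤, le_top, fun τ _ x hx => absurd hx (hne x)⟩
  -- (1b) the same for `λ − 1`
  obtain ⟨Am, hIAm, hAm⟩ : ∃ Am : Subgroup (absoluteGaloisGroup P.F), I ≤ Am ∧
      ∀ τ ∈ Am, ∀ x : F, x ^ 2 = algebraMap P.F F P.x - 1 →
        Field.absoluteGaloisGroup.toAlgEquiv P.F τ (φ x) = φ x := by
    rcases hev1 with ⟨m1, hm1⟩ | hne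
    · refine ⟨sqrtFixer P (P.x - 1), fun σ hσ => ?_, fun τ hτ x hx => ?_⟩
      · exact mem_fixingSubgroup_adjoin_of_forall_eq (σ := Field.absoluteGaloisGroup.toAlgEquiv P.F σ)
          fun z hz => smul_eq_of_mem_inertia_of_sq_eq_of_valuation_eq_exp_even v h𝔓 hσ h2' hm1 hz
      · have : (φ x) ^ 2 = algebraMap P.F Ω (P.x - 1) := by
          rw [← map_pow, hx, map_sub, map_one, φ.commutes, map_sub, map_one]
        exact forall_eq_of_mem_fixingSubgroup_adjoin hτ _ this
    · exact ⟨⊤, le_top, fun τ _ x hx => absurd hx (hne x)⟩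
  -- (1) `I ≤ A := sqrtFixer(−1) ⊓ (Al ⊓ Am)`
  set A : Subgroup (absoluteGaloisGroup P.F) := sqrtFixer P (-1) ⊓ (Al ⊓ Am) with hAdef
  have hIA : I ≤ A := by
    intro σ hσ
    refine ⟨mem_fixingSubgroup_adjoin_of_forall_eq (σ := Field.absoluteGaloisGroup.toAlgEquiv P.F σ)
        fun z hz => ?_, hIAl hσ, hIAm hσ⟩
    -- `z² = −1`: `z⁴ = 1`
    have hz : z ^ 2 = algebraMap P.F Ω (-1) := hz
    have hz4 : z ^ 4 = 1 := by
      rw [show (4 : ℕ) = 2 * 2 by norm_num, pow_mul, hz, map_neg, map_one]; norm_num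
    exact smul_eq_of_mem_inertia_of_pow_eq_one v h𝔓 hσ h4 hz4
  -- (2) the gens-fixer `H ≤ Gal(F̄_tpd/L)`
  set K3 : Subgroup (absoluteGaloisGroup P.F) := (P.legendreCurve.galoisRepTorsion ((3 : ℕ) : ℤ)).ker with hK3
  set K5 : Subgroup (absoluteGaloisGroup P.F) := (P.legendreCurve.galoisRepTorsion ((5 : ℕ) : ℤ)).ker with hK5
  set H : Subgroup (absoluteGaloisGroup P.F) := K3 ⊓ K5 ⊓ A with hHdef
  have hHN : H ≤ L.fixingSubgroup := by
    intro τ hτ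
    refine mem_fixingSubgroup_adjoin_of_forall_eq (σ := Field.absoluteGaloisGroup.toAlgEquiv P.F τ) fun s hs => ?_
    obtain ⟨x, hx, rfl⟩ := hs
    rcases hx with (hsq | hsq | hsq) | htor
    · -- `x² = −1`
      have : (φ x) ^ 2 = algebraMap P.F Ω (-1) := by rw [← map_pow, hsq, map_neg, map_one, map_neg, map_one]
      exact forall_eq_of_mem_fixingSubgroup_adjoin hτ.2.1 _ this
    · -- `x² = λ` with `x ∈ F`: handled by `Al`
      exact hAl τ hτ.2.2.1 x hsq
    · -- `x² = λ − 1` with `x ∈ F`: handled by `Am`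
      exact hAm τ hτ.2.2.2 x hsq
    · -- a `15`-torsion coordinate: transport the point to `E_λ(F̄_tpd)`
      rw [torsionCoords_eq] at htor
      obtain ⟨T, hT, hxT⟩ := Set.mem_iUnion₂.1 htor
      have hT15 : (15 : ℤ) • T = 0 := hT
      let T' : geomPoints P.legendreCurve := Affine.Point.map (W' := P.legendreCurve.toAffine) φ T
      have hT' : (15 : ℤ) • T' = 0 := by
        change (15 : ℤ) • Affine.Point.map (W' := P.legendreCurve.toAffine) φ T = 0
        rw [← map_zsmul, hT15, map_zero]
      have h3' : ∀ Q : geomTorsion P.legendreCurve ((3 : ℕ) : ℤ), τ • Q = Q := by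
        intro Q
        have hQ := galoisRepTorsion_apply P.legendreCurve ((3 : ℕ) : ℤ) τ Q
        rw [(MonoidHom.mem_ker).1 hτ.1.1] at hQ
        exact hQ.symm
      have h5' : ∀ Q : geomTorsion P.legendreCurve ((5 : ℕ) : ℤ), τ • Q = Q := by
        intro Q
        have hQ := galoisRepTorsion_apply P.legendreCurve ((5 : ℕ) : ℤ) τ Q
        rw [(MonoidHom.mem_ker).1 hτ.1.2] at hQ
        exact hQ.symm
      have hfix : τ • T' = T' := smul_eq_of_fifteen τ h3' h5' T' hT'
      refine forall_coords_of_smul_eq P τ T' hfix (φ x) ?_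
      rcases T with _ | ⟨a, b, hab⟩
      · simp [pointCoords] at hxT
      · change φ x ∈ pointCoords (Affine.Point.map (W' := P.legendreCurve.toAffine) φ
          (Affine.Point.some a b hab))
        rw [Affine.Point.map_some]
        simp only [pointCoords, Set.mem_insert_iff, Set.mem_singleton_iff] at hxT ⊢
        rcases hxT with rfl | rfl
        · exact Or.inl rfl
        · exact Or.inr rfl
  -- (3) index bookkeeping along `I ≥ K3 ⊓ I ≥ K5 ⊓ (K3 ⊓ I)`: `[I : I ∩ K3 ∩ K5] ∣ 3·5`
  have hK3r : K3.relIndex I ∣ 3 := by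
    rw [hK3, Subgroup.relIndex_ker]
    exact P.legendreCurve.natCard_map_inertia_galoisRepTorsion_dvd_prime Nat.prime_three hmult h3' h𝔓
  have hK5r : K5.relIndex (K3 ⊓ I) ∣ 5 := by
    rw [hK5, Subgroup.relIndex_ker]
    have h5I : Nat.card (I.map (P.legendreCurve.galoisRepTorsion ((5 : ℕ) : ℤ))) ∣ 5 :=
      P.legendreCurve.natCard_map_inertia_galoisRepTorsion_dvd_prime Nat.prime_five hmult h5' h𝔓
    exact (Subgroup.card_dvd_of_le (Subgroup.map_mono inf_le_right)).trans h5I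
  have hG : (K5 ⊓ K3).relIndex I ∣ 15 := by
    rw [← Subgroup.relIndex_inf_mul_relIndex K5 K3 I]
    have h := mul_dvd_mul hK5r hK3r
    simpa using h
  -- `H ⊓ I ⊇ (K5 ⊓ K3) ⊓ I` (as `I ≤ A`), so `[I : H ∩ I] ∣ 15`
  have hHr : H.relIndex I ∣ 15 := by
    have hle : K5 ⊓ K3 ⊓ I ≤ H := by
      intro τ hτ
      exact ⟨⟨hτ.1.2, hτ.1.1⟩, hIA hτ.2⟩
    have h := Subgroup.relIndex_dvd_of_le_left I hle
    rw [Subgroup.inf_relIndex_right] at h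
    exact h.trans hG
  -- (4) `e(w | v)`, read on the inertia group of `Gal(L/F_tpd)`, divides `[I : I ∩ Gal(F̄/L)] ∣ [I : I ∩ H]`
  set Q : Ideal (𝓞 L) := w.asIdeal.map (RingOfIntegers.mapAlgEquiv e : 𝓞 F ≃ₐ[𝓞 P.F] 𝓞 L) with hQ
  haveI : Q.IsPrime := isPrime_map_mapAlgEquiv e w
  haveI : Q.LiesOver v.asIdeal := liesOver_map_mapAlgEquiv e w _
  rw [← ramificationIdx_map_mapAlgEquiv e w]
  set r : absoluteGaloisGroup P.F →* (L ≃ₐ[P.F] L) := AlgEquiv.restrictNormalHom L with hr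
  have hker : r.ker = L.fixingSubgroup := IntermediateField.restrictNormalHom_ker L
  have h1 : (𝔓.comap (ringOfIntegersToIntegralClosure (k := P.F) (Ω := Ω) L)).inertia (L ≃ₐ[P.F] L) ≤
      I.map r := by
    intro g hg
    obtain ⟨σ, hσ, hσg⟩ := @exists_mem_inertia_restrict_eq P.F _ _ L _ _ 𝔓 h𝔓.1 g hg
    refine ⟨σ, hσ, AlgEquiv.ext fun x => Subtype.ext ?_⟩
    change (algebraMap L Ω) ((σ.restrictNormal L) x) = (algebraMap L Ω) (g x)
    rw [AlgEquiv.restrictNormal_commutes]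
    exact hσg x
  have key : Q.ramificationIdx (𝓞 P.F) ∣ 15 := by
    rw [@ramificationIdx_eq_card_inertia_comap P.F _ _ L _ _ v 𝔓 h𝔓.1 h𝔓.2 Q _ _]
    have hdvd : Nat.card ((𝔓.comap (ringOfIntegersToIntegralClosure (k := P.F) (Ω := Ω) L)).inertia
        (L ≃ₐ[P.F] L)) ∣ L.fixingSubgroup.relIndex I := by
      have h := Subgroup.card_dvd_of_le h1
      rwa [← Subgroup.relIndex_ker I r, hker] at h
    exact hdvd.trans ((Subgroup.relIndex_dvd_of_le_left I hHN).trans hHr)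
  exact key

/-! ## At a genuine Θ-volume datum: the tower form `e(u | p) ∣ e(v₀ | p)·15·l` -/

namespace ThetaVolumeDatumAt

open Literature.IUT.HodgeTheaters

variable {l : ℕ} (T : ThetaVolumeDatumAt P l)

/-- **THE SHARPENED LOCAL TYPE, generator form: `e(u | p) ∣ e(v₀ | p)·15·l`** for every place `u` of the `l`-division field `K`
of a genuine Θ-volume datum, of residue characteristic `p ∉ {2, 3, 5, l}`, whose restriction `v₀ = u ∩ F_tpd` is a place where
`E_λ` is multiplicative over `F_tpd` and each of `λ`, `λ − 1` has even order OR no square root in `T.F`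
(`e(u|p) = e(v₀|p)·e(w|v₀)·e(u|w)`; `e(u|w) ∣ l` is abc-iut-S-d1's `ramificationIdx_dvd_prime`).
[cite: Mochizuki2012, IUTchIV Thm. 1.10 p. 22 and proof Steps (ii)–(iii) p. 24–26] [claim: Mochizuki2012, status: disputed] -/
theorem ramificationIdx_int_dvd_fifteen_mul_of_sq_ne
    (u : letI := T.instFieldK; letI := T.instNumberFieldK; HeightOneSpectrum (𝓞 T.K))
    (hu : letI := T.instFieldK; letI := T.instNumberFieldK; residueChar T.K u ∉ ({2, 3, 5, l} : Finset ℕ))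
    (hmult : letI := T.instFieldF; letI := T.instNumberFieldF; letI := T.instAlgebraF; letI := T.instFieldK
      letI := T.instNumberFieldK; letI := T.instAlgebraK
      P.legendreCurve.HasMultiplicativeReductionAt (finBelow P.F T.F (finBelow T.F T.K u)))
    (hev : letI := T.instFieldF; letI := T.instNumberFieldF; letI := T.instAlgebraF; letI := T.instFieldK
      letI := T.instNumberFieldK; letI := T.instAlgebraK
      (∃ m : ℤ, (finBelow P.F T.F (finBelow T.F T.K u)).valuation P.F P.x = WithZero.exp (2 * m)) ∨
        ∀ x : T.F, x ^ 2 ≠ algebraMap P.F T.F P.x)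
    (hev1 : letI := T.instFieldF; letI := T.instNumberFieldF; letI := T.instAlgebraF; letI := T.instFieldK
      letI := T.instNumberFieldK; letI := T.instAlgebraK
      (∃ m : ℤ, (finBelow P.F T.F (finBelow T.F T.K u)).valuation P.F (P.x - 1) = WithZero.exp (2 * m)) ∨
        ∀ x : T.F, x ^ 2 ≠ algebraMap P.F T.F P.x - 1) :
    (letI := T.instFieldK; letI := T.instNumberFieldK
     u.asIdeal.ramificationIdx ℤ) ∣
      (letI := T.instFieldF; letI := T.instNumberFieldF; letI := T.instAlgebraF; letI := T.instFieldK
       letI := T.instNumberFieldK; letI := T.instAlgebraK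
       (finBelow P.F T.F (finBelow T.F T.K u)).asIdeal.ramificationIdx ℤ) * 15 * l := by
  -- adapted from abc-iut-w4-d087's `ramificationIdx_int_dvd_fifteen_mul` (SubThetaFieldRamificationFifteen.lean)
  letI := T.instFieldF; letI := T.instNumberFieldF; letI := T.instAlgebraF; letI := T.instFieldK
  letI := T.instNumberFieldK; letI := T.instAlgebraK; letI := T.instFieldFbar; letI := T.instAlgebraFbar
  letI := T.instAlgebraKFbar; letI := T.instIsElliptic
  simp only [Finset.mem_insert, Finset.mem_singleton, not_or] at hu
  obtain ⟨h2, h3, h5, hul⟩ := hu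
  set w := finBelow T.F T.K u with hwdef
  set v₀ := finBelow P.F T.F w with hv₀def
  have hw : residueChar T.F w ∉ ({2, 3, 5} : Finset ℕ) := by
    rw [hwdef, residueChar_finBelow]
    simp only [Finset.mem_insert, Finset.mem_singleton, not_or]
    exact ⟨h2, h3, h5⟩
  have hKF : u.asIdeal.ramificationIdx (𝓞 T.F) ∣ l := T.ramificationIdx_dvd_prime u hul
  haveI : IsGalois P.F T.F := (T.towerFacts T.inU).1
  have hFtpd : w.asIdeal.ramificationIdx (𝓞 P.F) ∣ 15 :=
    ramificationIdx_subThetaField_dvd_fifteen_of_sq_ne T.F T.inU T.isSubThetaField w hmult hev hev1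
      (thirty_notMem_finBelow_of_residueChar_notMem w hw)
  -- `e(u|p) = e(v₀|p)·e(w|v₀)·e(u|w)`
  have hw_under : u.under (𝓞 T.F) = w := rfl
  have hv_under : w.under (𝓞 P.F) = v₀ := rfl
  haveI : w.asIdeal.IsMaximal := w.isMaximal
  haveI : v₀.asIdeal.IsMaximal := v₀.isMaximal
  have heuw : Ideal.ramificationIdx' w.asIdeal u.asIdeal = u.asIdeal.ramificationIdx (𝓞 T.F) :=
    Ideal.ramificationIdx'_eq_ramificationIdx w.asIdeal u.asIdeal w.ne_bot
  have hewv : Ideal.ramificationIdx' v₀.asIdeal w.asIdeal = w.asIdeal.ramificationIdx (𝓞 P.F) :=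
    Ideal.ramificationIdx'_eq_ramificationIdx v₀.asIdeal w.asIdeal v₀.ne_bot
  have heu : u.asIdeal.ramificationIdx ℤ =
      v₀.asIdeal.ramificationIdx ℤ * w.asIdeal.ramificationIdx (𝓞 P.F) * u.asIdeal.ramificationIdx (𝓞 T.F) := by
    rw [ThetaData.absRamificationIdx_eq_ramIdx_mul (F := T.F) u, hw_under,
      ramIdx_eq, ThetaData.absRamificationIdx_eq_ramIdx_mul (F := P.F) w, hv_under, ramIdx_eq, heuw, hewv]
  rw [heu]
  exact mul_dvd_mul (mul_dvd_mul dvd_rfl hFtpd) hKF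

/-- **At a RATIONAL point: `e(u | p) ∣ 15·l`** for every place `u` of the `l`-division field `K` of a genuine Θ-volume datum
at `(ratPoint q, l)`, of residue characteristic `p ∉ {2, 3, 5, l}`, provided that at the place of `ℚ` over `p` the Legendre curve
`y² = x(x−1)(x−q)` is multiplicative over `ℚ` and EACH of `q`, `q − 1` has even `p`-order OR no square root in `T.F`
(`e(v | p) = 1` over `ℚ`, `Fisher2016.ramificationIdx_int_rat_eq_one`): `K_u/ℚ_p` is tame of index dividing `15·l`.
[cite: Mochizuki2012, IUTchIV Thm. 1.10 p. 22 and proof Steps (ii)–(iii) p. 24–26] [claim: Mochizuki2012, status: disputed] -/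
theorem ramificationIdx_int_dvd_fifteen_mul_ratPoint_of_sq_ne {q : ℚ} {l : ℕ} (T : ThetaVolumeDatumAt (ratPoint q) l)
    {p : ℕ} (hp : p ∉ ({2, 3, 5, l} : Finset ℕ))
    (hmult : ∀ v : HeightOneSpectrum (𝓞 ℚ), Rat.HeightOneSpectrum.natGenerator v = p →
      (⟨0, -(1 + q), 0, q, 0⟩ : WeierstrassCurve ℚ).HasMultiplicativeReductionAt v)
    (hev : (∀ v : HeightOneSpectrum (𝓞 ℚ), Rat.HeightOneSpectrum.natGenerator v = p →
      ∃ m : ℤ, v.valuation ℚ q = WithZero.exp (2 * m)) ∨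
      (letI := T.instFieldF; letI := T.instAlgebraF; ∀ x : T.F, x ^ 2 ≠ algebraMap (ratPoint q).F T.F q))
    (hev1 : (∀ v : HeightOneSpectrum (𝓞 ℚ), Rat.HeightOneSpectrum.natGenerator v = p →
      ∃ m : ℤ, v.valuation ℚ (q - 1) = WithZero.exp (2 * m)) ∨
      (letI := T.instFieldF; letI := T.instAlgebraF; ∀ x : T.F, x ^ 2 ≠ algebraMap (ratPoint q).F T.F q - 1))
    (u : letI := T.instFieldK; letI := T.instNumberFieldK; HeightOneSpectrum (𝓞 T.K))
    (hu : letI := T.instFieldK; letI := T.instNumberFieldK; residueChar T.K u = p) :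
    (letI := T.instFieldK; letI := T.instNumberFieldK
     u.asIdeal.ramificationIdx ℤ) ∣ 15 * l := by
  -- adapted from abc-iut-w4-d087's `ramificationIdx_int_dvd_fifteen_mul_ratPoint'` (SubThetaFieldRamificationFifteen.lean)
  letI := T.instFieldF; letI := T.instNumberFieldF; letI := T.instAlgebraF; letI := T.instFieldK
  letI := T.instNumberFieldK; letI := T.instAlgebraK
  set v : HeightOneSpectrum (𝓞 ℚ) := finBelow (ratPoint q).F T.F (finBelow T.F T.K u) with hvdef
  have hvp : Rat.HeightOneSpectrum.natGenerator v = p := by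
    have hchar : residueChar ℚ v = p := by
      rw [hvdef]
      change residueChar (ratPoint q).F (finBelow (ratPoint q).F T.F (finBelow T.F T.K u)) = p
      rw [residueChar_finBelow, residueChar_finBelow, hu]
    have hpp : p.Prime := hchar ▸ residueChar_prime ℚ v
    have hmem : ((p : ℕ) : 𝓞 ℚ) ∈ v.asIdeal := by
      rw [natCast_mem_asIdeal_iff_residueChar_eq v hpp]; exact hchar
    have hdvd := (Literature.NumberTheory.DiophantineGeometry.UniformABCConjecture.natCast_mem_asIdeal_iff v p).1 hmem
    exact (Nat.prime_dvd_prime_iff_eq (Rat.HeightOneSpectrum.prime_natGenerator v) hpp).1 hdvd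
  have hev' : (∃ m : ℤ, (finBelow (ratPoint q).F T.F (finBelow T.F T.K u)).valuation (ratPoint q).F (ratPoint q).x =
      WithZero.exp (2 * m)) ∨ ∀ x : T.F, x ^ 2 ≠ algebraMap (ratPoint q).F T.F (ratPoint q).x := by
    rcases hev with h | h
    · exact Or.inl (h v hvp)
    · exact Or.inr h
  have hev1' : (∃ m : ℤ, (finBelow (ratPoint q).F T.F (finBelow T.F T.K u)).valuation (ratPoint q).F
      ((ratPoint q).x - 1) = WithZero.exp (2 * m)) ∨ ∀ x : T.F, x ^ 2 ≠ algebraMap (ratPoint q).F T.F (ratPoint q).x - 1 := by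
    rcases hev1 with h | h
    · exact Or.inl (h v hvp)
    · exact Or.inr h
  have h := T.ramificationIdx_int_dvd_fifteen_mul_of_sq_ne u (by rw [hu]; exact hp) (hmult v hvp) hev' hev1'
  have h1 : (finBelow (ratPoint q).F T.F (finBelow T.F T.K u)).asIdeal.ramificationIdx ℤ = 1 :=
    Literature.NumberTheory.EllipticCurves.Fisher2016.ramificationIdx_int_rat_eq_one _
  rw [h1, one_mul] at h
  exact h

end ThetaVolumeDatumAt

end Cor22

end Literature.IUT.LogVolume

end
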